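import Mathlib
import Summits.CriticalPhenomena.Ising3DConformalLimit.Theses.GaussianScaleMixture
import Summits.CriticalPhenomena.Ising3DConformalLimit.Theorems.GaussianScaleMixtureCriticalTwoPointGSMExistsExchangeableRepOfRep
import Summits.CriticalPhenomena.Ising3DConformalLimit.Theorems.GaussianScaleMixtureCriticalTwoPointGSMGsmClosureOfTight

/-!
# The crux `CriticalTwoPointGSM` is a cube representation without face mass

Pure measure theory (two push-forwards), used by line `Sketch` of the crux `CriticalTwoPointGSM`
(stmt-CriticalPhenomena-8365). The crux says that the critical two-point function
`G = criticalTwoPoint 3` of the nearest-neighbour Ising model on `ℤ³` is a Gaussian scale mixture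
`G x = ∫ exp(-∑ᵢ sᵢ xᵢ²) dν(s)` with an exchangeable probability mixing measure `ν` carried by the
closed octant `[0,∞)³`. In CUBE COORDINATES `tᵢ = e^{-sᵢ} ∈ (0,1]` the kernel becomes the polynomial
kernel `∏ᵢ tᵢ^{xᵢ²}` (natural-number powers), and the octant becomes the half-open cube `(0,1]³`:
the faces `tᵢ = 0` of the closed cube `[0,1]³` are NOT reached. This file is the dictionary:

* `criticalTwoPointGSM_of_cubeRepNoFace`: a probability measure `μ` on `ℝ³` carried by `(0,1]³`
  (`μ {t | ∃ i, tᵢ ≤ 0 ∨ 1 < tᵢ} = 0`, no face mass) with `G x = ∫ ∏ᵢ tᵢ^{xᵢ²} dμ(t)` gives the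
  crux: pull back along `L t = (-log tᵢ)ᵢ` (a.e. `exp(-(-log tᵢ) xᵢ²) = tᵢ^{xᵢ²}` since `tᵢ > 0`),
  which lands in the closed octant since `-log tᵢ ≥ 0` for `tᵢ ∈ (0,1]`, and then symmetrise over
  `S₃` (`exists_exchangeable_rep_of_rep`).
* `cubeRepNoFace_of_criticalTwoPointGSM`: conversely, push the mixing measure of the crux forward
  along `E s = (e^{-sᵢ})ᵢ`, which maps the closed octant into `(0,1]³`, and use
  `∏ᵢ (e^{-sᵢ})^{xᵢ²} = exp(-∑ᵢ sᵢ xᵢ²)`.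
* `criticalTwoPointGSM_iff_cubeRepNoFace`: the equivalence.
-/

namespace Summit.CriticalPhenomena.Ising3DConformalLimit.Theorems

open MeasureTheory Filter Topology
open Literature.Probability.LatticeModels
open Summit.CriticalPhenomena.Ising3DConformalLimit.Theses.GaussianScaleMixture (CriticalTwoPointGSM)
open scoped BigOperators

namespace CriticalTwoPointGSMNoFace

/-- The coordinatewise logarithmic map `t ↦ (-log tᵢ)ᵢ` (cube → octant) is measurable. -/
theorem measurable_logMap : Measurable fun t : Fin 3 → ℝ => fun i => -Real.log (t i) :=
  measurable_pi_lambda _ fun i => (Real.measurable_log.comp (measurable_pi_apply i)).neg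

/-- The coordinatewise exponential map `s ↦ (e^{-sᵢ})ᵢ` (octant → cube) is measurable. -/
theorem measurable_expMap : Measurable fun s : Fin 3 → ℝ => fun i => Real.exp (-(s i)) :=
  measurable_pi_lambda _ fun i => Real.measurable_exp.comp (measurable_pi_apply i).neg

/-- The complement `{t | ∃ i, tᵢ ≤ 0 ∨ 1 < tᵢ}` of the half-open cube `(0,1]³` is measurable. -/
theorem measurableSet_offCubeNoFace :
    MeasurableSet {t : Fin 3 → ℝ | ∃ i, t i ≤ 0 ∨ 1 < t i} := by
  have : {t : Fin 3 → ℝ | ∃ i, t i ≤ 0 ∨ 1 < t i} = ⋃ i, ({t | t i ≤ 0} ∪ {t | 1 < t i}) := by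
    ext t; simp
  rw [this]
  exact MeasurableSet.iUnion fun i =>
    (measurableSet_le (measurable_pi_apply i) measurable_const).union
      (measurableSet_lt measurable_const (measurable_pi_apply i))

/-- A measure giving no mass to the complement of the half-open cube `(0,1]³` is carried by it:
almost every point has all coordinates in `(0,1]`. -/
theorem ae_mem_cubeNoFace {μ : Measure (Fin 3 → ℝ)} (h : μ {t | ∃ i, t i ≤ 0 ∨ 1 < t i} = 0) :
    ∀ᵐ t ∂μ, ∀ i, 0 < t i ∧ t i ≤ 1 := by
  rw [ae_iff]
  have : {t : Fin 3 → ℝ | ¬∀ i, 0 < t i ∧ t i ≤ 1} = {t | ∃ i, t i ≤ 0 ∨ 1 < t i} := by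
    ext t
    simp only [Set.mem_setOf_eq, not_forall, not_and_or, not_lt, not_le]
  rw [this]; exact h

/-- The logarithmic map sends the half-open cube `(0,1]³` into the closed octant: the preimage of
the complement `{s | ∃ i, sᵢ < 0}` of the octant lies in the complement of `(0,1]³`. -/
theorem preimage_logMap_exists_neg_subset :
    (fun t : Fin 3 → ℝ => fun i => -Real.log (t i)) ⁻¹' {s | ∃ i, s i < 0} ⊆
      {t | ∃ i, t i ≤ 0 ∨ 1 < t i} := by
  rintro t ⟨i, hi⟩
  refine ⟨i, ?_⟩
  by_contra hc
  simp only [not_or, not_le, not_lt] at hc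
  have h : Real.log (t i) ≤ 0 := Real.log_nonpos hc.1.le hc.2
  simp only [neg_lt_zero] at hi
  exact absurd hi (not_lt.2 h)

/-- The exponential map `s ↦ (e^{-sᵢ})ᵢ` sends the closed octant into the half-open cube `(0,1]³`:
the preimage of the complement of `(0,1]³` lies in the complement `{s | ∃ i, sᵢ < 0}` of the
octant. -/
theorem preimage_expMap_offCubeNoFace_subset :
    (fun s : Fin 3 → ℝ => fun i => Real.exp (-(s i))) ⁻¹' {t | ∃ i, t i ≤ 0 ∨ 1 < t i} ⊆
      {s | ∃ i, s i < 0} := by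
  rintro s ⟨i, hi⟩
  refine ⟨i, ?_⟩
  rcases hi with h | h
  · exact absurd h (not_le.2 (Real.exp_pos _))
  · have h' : (0 : ℝ) < -(s i) := by
      rw [← Real.exp_lt_exp, Real.exp_zero]; exact h
    linarith

/-- The polynomial kernel `t ↦ ∏ᵢ tᵢ^{|xᵢ|²}` is continuous. -/
theorem continuous_polyKernel (x : Site 3) :
    Continuous fun t : Fin 3 → ℝ => ∏ i, (t i) ^ ((x i).natAbs ^ 2) := by
  fun_prop

/-- On the open positive orthant the polynomial kernel is the Gaussian kernel at the logarithmic
parameter: `∏ᵢ tᵢ^{|xᵢ|²} = exp(-∑ᵢ (-log tᵢ) xᵢ²)` when all `tᵢ > 0`. -/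
theorem prod_pow_eq_exp_logMap (t : Fin 3 → ℝ) (ht : ∀ i, 0 < t i) (x : Site 3) :
    ∏ i, (t i) ^ ((x i).natAbs ^ 2) = Real.exp (-∑ i, (-Real.log (t i)) * ((x i : ℝ)) ^ 2) := by
  rw [← Finset.sum_neg_distrib, Real.exp_sum]
  refine Finset.prod_congr rfl fun i _ => ?_
  have hc : ((x i : ℝ)) ^ 2 = (((x i).natAbs ^ 2 : ℕ) : ℝ) := by
    push_cast
    rw [Nat.cast_natAbs, Int.cast_abs, sq_abs]
  rw [neg_mul, neg_neg, hc, mul_comm (Real.log (t i)), Real.exp_nat_mul, Real.exp_log (ht i)]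

/-- Pulling a cube representation without face mass back along the logarithmic map gives a
Gaussian-scale-mixture representation: for `μ` carried by `(0,1]³`,
`∫ ∏ᵢ tᵢ^{|xᵢ|²} dμ = ∫ exp(-∑ᵢ sᵢ xᵢ²) d(L_* μ)` with `L t = (-log tᵢ)ᵢ`. -/
theorem integral_polyKernel_eq_integral_map_logMap {μ : Measure (Fin 3 → ℝ)}
    (h : μ {t | ∃ i, t i ≤ 0 ∨ 1 < t i} = 0) (x : Site 3) :
    ∫ t, ∏ i, (t i) ^ ((x i).natAbs ^ 2) ∂μ =
      ∫ s, Real.exp (-∑ i, s i * ((x i : ℝ)) ^ 2)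
        ∂(μ.map fun t : Fin 3 → ℝ => fun i => -Real.log (t i)) := by
  rw [integral_map measurable_logMap.aemeasurable
    (CriticalTwoPointGSMSymm.continuous_kernel x).aestronglyMeasurable]
  refine integral_congr_ae ?_
  filter_upwards [ae_mem_cubeNoFace h] with t ht
  exact prod_pow_eq_exp_logMap t (fun i => (ht i).1) x

/-- Pushing a Gaussian-scale-mixture representation forward along the exponential map gives a cube
representation: `∫ ∏ᵢ tᵢ^{|xᵢ|²} d(E_* ν) = ∫ exp(-∑ᵢ sᵢ xᵢ²) dν` with `E s = (e^{-sᵢ})ᵢ` (no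
support hypothesis needed; `∏ᵢ (e^{-sᵢ})^{|xᵢ|²} = exp(-∑ᵢ sᵢ xᵢ²)` pointwise). -/
theorem integral_polyKernel_map_expMap (ν : Measure (Fin 3 → ℝ)) (x : Site 3) :
    ∫ t, ∏ i, (t i) ^ ((x i).natAbs ^ 2) ∂(ν.map fun s : Fin 3 → ℝ => fun i => Real.exp (-(s i))) =
      ∫ s, Real.exp (-∑ i, s i * ((x i : ℝ)) ^ 2) ∂ν := by
  rw [integral_map measurable_expMap.aemeasurable (continuous_polyKernel x).aestronglyMeasurable]
  refine integral_congr_ae (Eventually.of_forall fun s => ?_)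
  -- `∏ᵢ (e^{-sᵢ})^{|xᵢ|²} = exp(-∑ᵢ sᵢ xᵢ²)`: the case `t = E s` of `prod_pow_eq_exp_logMap`.
  have h := prod_pow_eq_exp_logMap (fun i => Real.exp (-(s i))) (fun i => Real.exp_pos _) x
  simp only [Real.log_exp, neg_neg] at h
  exact h

end CriticalTwoPointGSMNoFace

open CriticalTwoPointGSMNoFace in
/-- **A cube representation without face mass gives the crux `CriticalTwoPointGSM`.** If the
critical two-point function `criticalTwoPoint 3` of the nearest-neighbour Ising model on `ℤ³` is
represented as `∫ ∏ᵢ tᵢ^{xᵢ²} dμ(t)` by a probability measure `μ` on `ℝ³` carried by the half-open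
cube `(0,1]³` (`μ {t | ∃ i, tᵢ ≤ 0 ∨ 1 < tᵢ} = 0`: no mass on the faces `tᵢ = 0`), then it is a
Gaussian scale mixture with an exchangeable probability mixing measure on the closed octant: pull
`μ` back along `sᵢ = -log tᵢ ∈ [0,∞)` (so that `exp(-sᵢ xᵢ²) = tᵢ^{xᵢ²}` for `tᵢ ∈ (0,1]`) and
symmetrise over `S₃` (`exists_exchangeable_rep_of_rep`). -/
theorem criticalTwoPointGSM_of_cubeRepNoFace
    (h : ∃ μ : Measure (Fin 3 → ℝ), IsProbabilityMeasure μ ∧ μ {t | ∃ i, t i ≤ 0 ∨ 1 < t i} = 0 ∧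
      ∀ x : Site 3, criticalTwoPoint 3 x = ∫ t, ∏ i, (t i) ^ ((x i).natAbs ^ 2) ∂μ) :
    CriticalTwoPointGSM := by
  obtain ⟨μ, hP, hcube, hrep⟩ := h
  let L : (Fin 3 → ℝ) → (Fin 3 → ℝ) := fun t i => -Real.log (t i)
  have hL : Measurable L := measurable_logMap
  have hPν : IsProbabilityMeasure (μ.map L) := Measure.isProbabilityMeasure_map hL.aemeasurable
  have hoct : μ.map L {s | ∃ i, s i < 0} = 0 := by
    rw [Measure.map_apply hL CriticalTwoPointGSMClosure.isOpen_exists_neg.measurableSet]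
    exact measure_mono_null preimage_logMap_exists_neg_subset hcube
  have hrepν : ∀ x : Site 3,
      criticalTwoPoint 3 x = ∫ s, Real.exp (-∑ i, s i * ((x i : ℝ)) ^ 2) ∂(μ.map L) := fun x => by
    rw [hrep x]
    exact integral_polyKernel_eq_integral_map_logMap hcube x
  exact exists_exchangeable_rep_of_rep (μ.map L) hPν hoct hrepν

open CriticalTwoPointGSMNoFace in
/-- **The crux `CriticalTwoPointGSM` gives a cube representation without face mass.** If
`criticalTwoPoint 3` is a Gaussian scale mixture `∫ exp(-∑ᵢ sᵢ xᵢ²) dν(s)` with a probability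
mixing measure on the closed octant, then the push-forward `μ = E_* ν` along `E s = (e^{-sᵢ})ᵢ` is
a probability measure carried by the half-open cube `(0,1]³` with
`criticalTwoPoint 3 x = ∫ ∏ᵢ tᵢ^{xᵢ²} dμ(t)` (`∏ᵢ (e^{-sᵢ})^{xᵢ²} = exp(-∑ᵢ sᵢ xᵢ²)`). -/
theorem cubeRepNoFace_of_criticalTwoPointGSM (h : CriticalTwoPointGSM) :
    ∃ μ : Measure (Fin 3 → ℝ), IsProbabilityMeasure μ ∧ μ {t | ∃ i, t i ≤ 0 ∨ 1 < t i} = 0 ∧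
      ∀ x : Site 3, criticalTwoPoint 3 x = ∫ t, ∏ i, (t i) ^ ((x i).natAbs ^ 2) ∂μ := by
  obtain ⟨ν, hP, hoct, -, hrep⟩ := h
  let E : (Fin 3 → ℝ) → (Fin 3 → ℝ) := fun s i => Real.exp (-(s i))
  have hE : Measurable E := measurable_expMap
  refine ⟨ν.map E, Measure.isProbabilityMeasure_map hE.aemeasurable, ?_, fun x => ?_⟩
  · rw [Measure.map_apply hE measurableSet_offCubeNoFace]
    exact measure_mono_null preimage_expMap_offCubeNoFace_subset hoct
  · rw [hrep x]
    exact (integral_polyKernel_map_expMap ν x).symm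

/-- **The crux `CriticalTwoPointGSM` is exactly a cube representation without face mass** of the
critical two-point function: `criticalTwoPoint 3 x = ∫ ∏ᵢ tᵢ^{xᵢ²} dμ(t)` for a probability
measure `μ` on `ℝ³` carried by the half-open cube `(0,1]³` (cube coordinates `tᵢ = e^{-sᵢ}`;
exchangeability of the mixing measure is free by `S₃`-symmetrisation). -/
theorem criticalTwoPointGSM_iff_cubeRepNoFace :
    CriticalTwoPointGSM ↔
      ∃ μ : Measure (Fin 3 → ℝ), IsProbabilityMeasure μ ∧ μ {t | ∃ i, t i ≤ 0 ∨ 1 < t i} = 0 ∧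
        ∀ x : Site 3, criticalTwoPoint 3 x = ∫ t, ∏ i, (t i) ^ ((x i).natAbs ^ 2) ∂μ :=
  ⟨cubeRepNoFace_of_criticalTwoPointGSM, criticalTwoPointGSM_of_cubeRepNoFace⟩

end Summit.CriticalPhenomena.Ising3DConformalLimit.Theorems
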